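import Summits.QuantumFields.YangMills.Theorems.CovariantDischargeHistoryTailOfSandwichSplit
import Summits.QuantumFields.YangMills.Theorems.FirstExitWindowOneStepWindowL
import Summits.QuantumFields.YangMills.Theorems.UnitScaleTiltHistoryTailBoundedHeightLocal
import Summits.QuantumFields.YangMills.Theorems.CovariantDischargeSweepGapReduction
import Literature.MathematicalPhysics.QuantumFieldTheory.Balaban1983to89.T4PairDerivBridge

/-!
# Skeleton line «sandwich_discharge» (v5 — RESHAPED after the located corner ‼ `LOCATE-SWGAP-px8g6`) for crux stmt-QuantumFields-19936
# `UnitScaleTilt.HistoryTailL` (ideator seat ym-r3-idea-2 g13, LINE 24 «SeveritySandwich» = rev-1 repair of route-QuantumFields-CovariantDischarge;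
# route items stmt-QuantumFields-24186 `SandwichFractionalWindowTailL` (crux r2), 24187 `SandwichDeepWindowTailL` (crux r3, residual),
# 24188 `HistoryTailOfSandwichSplit` (support r9, the DOOR — landed p705015 + p705200))

WHY v5.  The v4 load-bearing stub `stub_sandwichSweepGap` was typed on the whole small regime `θ_{Λb}(K−j) ≤ 1`, `∀ b ≥ b₀`.  px8 g6's
quantifier audit (19936 evidence #53, 2026-08-29T08:18Z) located a CORNER: by lattice WRAP-AROUND of Bałaban's averages, the exact critical
points `V_unif(t)` (uniform abelian flux, level-j angle `2π·L^{−2t}`, all coarser averaged holonomies EXACTLY 1) lie INSIDE the sandwich event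
for `x := θ_{Λb}(K−j)` in an explicit sub-interval of `(0,1]`, for every odd `L ≥ 3` and every `Λ > 1`, and there every V-covariant sweep has
gain `≤ 0` (✓p658705 `CovariantDischargeSweepNoGain`).  The text was not refuted (Ψ′ is ∃-bound, arbitrary) but its MECHANISM is dead on that
sub-range (v4 card's witness exclusion used the small-angle computation and missed the wrap).  REPAIR adopted verbatim from the LOCATE §3:
a SEVERITY CAP `b ≤ 2·(151L²)^j·b₀` on the sweep stub (then `x ≤ L^{−cj}` once `N₁ > 2c + 5 + 2·log_L 151`: the critical points are out and
the sweep regime is fully perturbative), the complementary LARGE-BASE branch `2·(151L²)^j·b₀ ≤ b` as a new crude stub (locality pays the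
ladder: w5 g13's (α′)), and the landed large-threshold regime ✓p708497.

REGISTERED STUBS (the only sorries of this file):
* `stub_sandwichSweepGapCapped` — XL, THE LOAD-BEARING STUB (S′): deep heights `j₀ < j`, coupled range `N₁·j + n ≤ K`, CAPPED severity
  `b₀ ≤ b ≤ 2(151L²)^j b₀`, small regime `θ_{Λb}(K−j) ≤ 1`: for every unit direction `v` a Haar-measure-preserving bijection `Ψ` of the
  unit-scale field space (covariant Cameron–Martin sweep along the plaquette-to-cube profile) whose undoing gains `≥ (c_g·p_{b₀}(g_{K−j})² − D)/β_K`
  of action on the SANDWICH ∩ linear-window event; brick map B1′–B6 in the card.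
* `stub_sandwichLargeBase` — M (α′): LARGE BASE `2(151L²)^j b₀ ≤ b`, every height `j + n ≤ K`, no regime, no coupling: the sandwich event is
  `≤ C·β_{K−j}^N·e^{−c·p_{b₀}(g_{K−j})²}` (footprint threshold `θ_b/(151L²)^j ≥ 2θ_{b₀}`: locality loss paid by the severity itself) — the statement
  of seat ym-ust-19936-w5 g13's `CovariantDischargeSandwichLargeBase.sandwichTail_of_large_base` (SIGNATURE 08:23:10Z, dc36a224) TOKEN FOR TOKEN.
* `stub_sandwichDeep` — the route's RESIDUAL item `SandwichDeepWindowTailL` verbatim (organ-class remainder `K < N₁·j + n`).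
* `stub_sandwichLarge` — ✓ LANDED p708497 (`Theorems.CovariantDischargeSandwichLarge.stub_sandwichLarge`, seat w5 g13; large-threshold regime
  `1 < θ_{Λb}(K−j)`); header byte-identical to v4; its `sorry` is a placeholder until the farm snapshot serves that olean (v5b swaps the term in).
PROVED (no sorry): `sandwichBoundedDepth` (depth `j ≤ j₀`; also landed as ✓p706476);
the regime merge `sandwichSweep_of_capped_large_base` (3-way: cap ∧ small → S′ via the landed window reduction
`CovariantDischargeSweepGapReduction.measureReal_dist1_window_le_card_mul_exp` + direction net; cap ∧ large → ✓p708497; ¬cap → (α′));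
`sandwichFractional_of_ranges`; and the composition `HistoryTailL_of : SandwichDeepWindowTailL → UnitScaleTilt.HistoryTailL` (the crux BY
NAME) through the landed door `SandwichDischargeDoor.door`.
Rung R3 (`YM3TorusSU2`) is a RECORD rung, not the Clay statement; nothing here is proved about the Yang–Mills mass gap.
-/

noncomputable section

open MeasureTheory Filter Topology
open Literature.MathematicalPhysics.QuantumFieldTheory.Balaban1983to89
open Literature.MathematicalPhysics.QuantumFieldTheory.Balaban1983to89.Missing
open Literature.MathematicalPhysics.QuantumFieldTheory.Balaban1983to89.T4Continuum
open Literature.MathematicalPhysics.QuantumFieldTheory.Balaban1983to89.T3ContinuumYM3Torus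
open Literature.MathematicalPhysics.QuantumFieldTheory.Balaban1983to89.T3UnitScaleTilt
open Literature.MathematicalPhysics.QuantumFieldTheory.Balaban1983to89.T3UnitLawDensityEML (ℰp measurableE_ℰp)
open Literature.MathematicalPhysics.QuantumFieldTheory.Balaban1983to89.T3HistoryTailReduction
open Literature.MathematicalPhysics.QuantumFieldTheory.Balaban1983to89.T3BareTailProfile
open Literature.MathematicalPhysics.QuantumFieldTheory.Balaban1983to89.T3AveragedTailProfile
/-! ## The skeleton: registered stubs and the kernel-checked composition -/

namespace Summit.QuantumFields.YangMills.Cruxes.HistoryTailL.SandwichDischarge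

open MeasureTheory
open scoped RealInnerProductSpace
open Literature.MathematicalPhysics.QuantumLattice (su2Quat)
open Literature.MathematicalPhysics.QuantumFieldTheory.Balaban1983to89.T3UnitLawDensityEML (ℰp)
open Literature.MathematicalPhysics.QuantumFieldTheory.Balaban1983to89.T4CubeChartGnomonic (SU2)
open Literature.MathematicalPhysics.QuantumFieldTheory.Balaban1983to89.T4ExpWindowSmallField (imVec)
open Literature.MathematicalPhysics.QuantumFieldTheory.Balaban1983to89.T3MinimiserStabilityReduction (θBal_pos)
open Summit.QuantumFields.YangMills.Theorems.CovariantDischargeDirectionNet (exists_finset_sphere_inner_ge)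
open Summit.QuantumFields.YangMills.Theorems.CovariantDischargeSweepGapReduction (measureReal_dist1_window_le_card_mul_exp)
open Literature.MathematicalPhysics.QuantumFieldTheory.Balaban1983to89
open Literature.MathematicalPhysics.QuantumFieldTheory.Balaban1983to89.T3ContinuumYM3Torus
open Summit.QuantumFields.YangMills.Theses.CovariantDischarge

/-- `θBal` is monotone in the profile constant `b` (linear: `θBal_const_mul`; nonnegative for `0 < γ ≤ 1`, `1 ≤ L`). [folklore] -/
theorem θBal_le_θBal_of_le {L : ℕ} (hL : 1 ≤ L) {γ : ℝ} (hγ : 0 < γ) (hγ1 : γ ≤ 1) {b₀ b : ℝ} (hb₀ : 0 < b₀) (hb : b₀ ≤ b)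
    (p₀ : ℝ) (i : ℕ) : T3UnitScaleTilt.θBal L γ b₀ p₀ i ≤ T3UnitScaleTilt.θBal L γ b p₀ i := by
  have hL0 : (0 : ℝ) < L := by exact_mod_cast (Nat.one_pos.trans_le hL)
  have hLi : (0 : ℝ) < ((L : ℝ)⁻¹) ^ i := pow_pos (inv_pos.mpr hL0) i
  have hg0 : 0 < Real.sqrt (γ * ((L : ℝ)⁻¹) ^ i) := Real.sqrt_pos.mpr (mul_pos hγ hLi)
  have hg1 : Real.sqrt (γ * ((L : ℝ)⁻¹) ^ i) ≤ 1 := by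
    rw [Real.sqrt_le_one]
    have h1 : ((L : ℝ)⁻¹) ^ i ≤ 1 :=
      pow_le_one₀ (inv_nonneg.mpr hL0.le) (inv_le_one_of_one_le₀ (by exact_mod_cast hL))
    calc γ * ((L : ℝ)⁻¹) ^ i ≤ 1 * 1 := mul_le_mul hγ1 h1 hLi.le zero_le_one
      _ = 1 := one_mul 1
  have hθ0 : 0 ≤ T3UnitScaleTilt.θBal L γ b₀ p₀ i := by
    unfold T3UnitScaleTilt.θBal
    exact mul_nonneg (Real.sqrt_nonneg _) (B10.pFun_nonneg b₀ p₀ _ hb₀.le hg0 hg1)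
  have hbb : b = (b / b₀) * b₀ := by field_simp
  have hr : 1 ≤ b / b₀ := by rwa [le_div_iff₀ hb₀, one_mul]
  calc T3UnitScaleTilt.θBal L γ b₀ p₀ i = 1 * T3UnitScaleTilt.θBal L γ b₀ p₀ i := (one_mul _).symm
    _ ≤ (b / b₀) * T3UnitScaleTilt.θBal L γ b₀ p₀ i := mul_le_mul_of_nonneg_right hr hθ0
    _ = T3UnitScaleTilt.θBal L γ ((b / b₀) * b₀) p₀ i :=
        (Summit.QuantumFields.YangMills.Theorems.OneStepWindowL.θBal_const_mul L γ (b / b₀) b₀ p₀ i).symm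
    _ = T3UnitScaleTilt.θBal L γ b p₀ i := by rw [← hbb]

/-- PROVED (S): bounded depth `j ≤ j₀`, ladder-uniform: the sandwich event at base `b ≥ b₀` lies in the plain tail
`{θ(b₀)(K−j) ≤ dist1(Ū^j(∂p))}`, bounded profile-uniformly by `HistoryTailBoundedHeightLocal.perPlaquette_boundedHeight_uniform L j₀`
(`γ₁ = 1`, `N = 5`). [cite: Balaban1985UV3, (7) p.257 and (71) p.273; Balaban1985Averaging, Prop. 1 (51) p.26] -/
theorem sandwichBoundedDepth : ∀ (L j₀ : ℕ) (b₀ p₀ Λ : ℝ), 0 < b₀ → 2 < p₀ → 1 < Λ →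
    ∃ (γ₁ C c : ℝ) (N : ℕ), 0 < γ₁ ∧ γ₁ ≤ 1 ∧ 0 < c ∧ ∀ (F : T3Family) (γ : ℝ), F.L = L → 0 < γ → γ ≤ γ₁ →
      ∀ (b : ℝ), b₀ ≤ b → ∀ (K n j : ℕ), j ≤ j₀ → j + n ≤ K → ∀ p : Plaq (F.P K) j,
        (T3UnitScaleTilt.gibbsK F T3UnitLawDensityEML.ℰp γ K).real
          {U | (∀ k, k < j → PlaqSmall (T3UnitScaleTilt.θBal F.L γ b p₀ (K - k))
                (Averaging.iter (fun i => BlockAveraging.blockAvg (P := F.P K) (j := i) T3UnitLawDensityEML.ℰp) k U)) ∧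
              (∀ j', j ≤ j' → j' + n ≤ K → PlaqSmall (T3UnitScaleTilt.θBal F.L γ (Λ * b) p₀ (K - j'))
                (Averaging.iter (fun i => BlockAveraging.blockAvg (P := F.P K) (j := i) T3UnitLawDensityEML.ℰp) j' U)) ∧
              T3UnitScaleTilt.θBal F.L γ b p₀ (K - j) ≤ GaugeGroup.dist1 (GaugeField.plaqHol
                (Averaging.iter (fun i => BlockAveraging.blockAvg (P := F.P K) (j := i) T3UnitLawDensityEML.ℰp) j U) p)}
        ≤ C * ((γ * ((F.L : ℝ)⁻¹) ^ (K - j))⁻¹) ^ N *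
            Real.exp (-(c * B10.pFun b₀ p₀ (Real.sqrt (γ * ((F.L : ℝ)⁻¹) ^ (K - j))) ^ 2)) := by
  intro L j₀ b₀ p₀ Λ hb₀ _hp₀ _hΛ
  obtain ⟨C, c, _hC, hc, h⟩ :=
    Summit.QuantumFields.YangMills.Theorems.HistoryTailBoundedHeightLocal.perPlaquette_boundedHeight_uniform L j₀
  refine ⟨1, C, c, 5, one_pos, le_rfl, hc, fun F γ hFL hγ hγ1 b hb K n j hj0 hjK p => ?_⟩
  haveI := T3UnitScaleTilt.isProbabilityMeasure_gibbsK F T3UnitLawDensityEML.ℰp hγ.le K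
  have hjK' : j ≤ K := le_trans (Nat.le_add_right j n) hjK
  have hmain := h F hFL γ hγ hγ1 b₀ hb₀.le p₀ K j hjK' hj0 p
  refine le_trans (measureReal_mono (fun U hU => ?_) (measure_ne_top _ _)) hmain
  have hL : 1 ≤ F.L := F.hL.2.le
  exact (θBal_le_θBal_of_le hL hγ hγ1 hb₀ hb p₀ (K - j)).trans hU.2.2

/-- STUB 1a′ (XL, LOAD-BEARING — (S′) of `LOCATE-SWGAP-px8g6` §3): sweep gaps on the SANDWICH event in the small-threshold regime
`θ(Λb)(K−j) ≤ 1` AND CAPPED SEVERITY `b₀ ≤ b ≤ 2·(151L²)^j·b₀`: for every depth `j₀ < j`, coupled range `N₁·j + n ≤ K`, plaquette `p` and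
unit direction `v ∈ ℝ³`, a `dU`-preserving measurable bijection `(Ψ, Ψ′)` of the level-`K` fine fields whose undoing lowers `β_K·A` by
`≥ c_g·p(g_{K−j})(b₀)² − D` on «finer heights θ(b)-small ∧ coarser heights `j′ ∈ [j, K−n]` θ(Λb)-small ∧ linear window condition at `p`».
Under the cap `x = θ(Λb)(K−j) ≤ 2Λ(151L²)^j·θ(b₀)(K−j) ≤ L^{−c·j}` for `j > j₀` as soon as `N₁ > 2c + 5 + 2·log_L 151` — the wrap-around
critical points `V_unif(t)` (gain ≤ 0, ✓`CovariantDischargeSweepNoGain`) need `x > x_lo(t_Λ) > 0` and are EXCLUDED, and every loop of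
diameter `≤ R·L^j` is `o(1)`-close to 1 (fully perturbative sweep regime).  `c_g ≲ 1` is forced (LOCATE §1(b)).  Constants uniform in `b`.
[cite: Balaban1985UV3, (1)-(3) p.256, (7) p.257, (71) p.273; Balaban1985Averaging, Prop. 1 (51) p.26] -/
theorem stub_sandwichSweepGapCapped : ∀ (L : ℕ), ∃ N₁ : ℕ, 0 < N₁ ∧ ∀ (b₀ p₀ Λ : ℝ), 0 < b₀ → 2 < p₀ → 1 < Λ →
    ∃ (j₀ : ℕ) (γ₁ cg D δ : ℝ), 0 < γ₁ ∧ γ₁ ≤ 1 ∧ 0 < cg ∧ 0 < δ ∧ δ ^ 2 ≤ 2 ∧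
      ∀ (F : T3Family) (γ : ℝ), F.L = L → 0 < γ → γ ≤ γ₁ → ∀ (b : ℝ), b₀ ≤ b → ∀ (K n j : ℕ), j₀ < j → N₁ * j + n ≤ K →
        b ≤ 2 * (151 * (F.L : ℝ) ^ 2) ^ j * b₀ → T3UnitScaleTilt.θBal F.L γ (Λ * b) p₀ (K - j) ≤ 1 →
        ∀ (p : Plaq (F.P K) j) (v : EuclideanSpace ℝ (Fin 3)), ‖v‖ = 1 →
          ∃ (Ψ Ψ' : GaugeField (F.P K) 0 (Matrix.specialUnitaryGroup (Fin 2) ℂ) → GaugeField (F.P K) 0 (Matrix.specialUnitaryGroup (Fin 2) ℂ)),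
            MeasurePreserving Ψ (fieldMeasure (F.P K) 0 (Matrix.specialUnitaryGroup (Fin 2) ℂ)) (fieldMeasure (F.P K) 0 (Matrix.specialUnitaryGroup (Fin 2) ℂ)) ∧ Measurable Ψ' ∧
            Function.LeftInverse Ψ' Ψ ∧ Function.RightInverse Ψ' Ψ ∧
            ∀ V : GaugeField (F.P K) 0 (Matrix.specialUnitaryGroup (Fin 2) ℂ),
              (∀ k, k < j → PlaqSmall (T3UnitScaleTilt.θBal F.L γ b p₀ (K - k))
                (Averaging.iter (fun i => BlockAveraging.blockAvg (P := F.P K) (j := i) T3UnitLawDensityEML.ℰp) k V)) →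
              (∀ j', j ≤ j' → j' + n ≤ K → PlaqSmall (T3UnitScaleTilt.θBal F.L γ (Λ * b) p₀ (K - j'))
                (Averaging.iter (fun i => BlockAveraging.blockAvg (P := F.P K) (j := i) T3UnitLawDensityEML.ℰp) j' V)) →
              (1 - δ ^ 2 / 2) * (T3UnitScaleTilt.θBal F.L γ b p₀ (K - j) *
                  Real.sqrt (1 - T3UnitScaleTilt.θBal F.L γ (Λ * b) p₀ (K - j) ^ 2 / 4)) ≤
                ⟪v, T4ExpWindowSmallField.imVec (Literature.MathematicalPhysics.QuantumLattice.su2Quat (GaugeField.plaqHol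
                  (Averaging.iter (fun i => BlockAveraging.blockAvg (P := F.P K) (j := i) T3UnitLawDensityEML.ℰp) j V) p))⟫ →
              cg * B10.pFun b₀ p₀ (Real.sqrt (γ * ((F.L : ℝ)⁻¹) ^ (K - j))) ^ 2 - D ≤
                (F.scheme T3UnitLawDensityEML.ℰp γ).β K * (wilsonAction4 V - wilsonAction4 (Ψ' V)) := by
  sorry

/-- STUB 1b — ✓ LANDED IN THE TREE (p708497, seat ym-ust-19936-w5 g13, `Theorems/CovariantDischargeSandwichLarge.stub_sandwichLarge`; registry:
landed): the LARGE regime `1 < θ(Λb)(K−j)` of the sandwich event, own `N₁ = 39`, `γ₁⁻¹ = Q³`, `C = 2e²⁴c₀⁻³`, `c = 1`, `N = 6`.  Header kept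
BYTE-IDENTICAL to the v4 registered stub; the `sorry` below stays only until the farm snapshot serves the olean of ✓p708497 (`remote:stale:…:unbuilt`
at v5 publication), then the proof term `Summit.QuantumFields.YangMills.Theorems.CovariantDischargeSandwichLarge.stub_sandwichLarge` replaces it
(v5b, no statement change). [cite: Balaban1985UV3, (3) p.256] -/
theorem stub_sandwichLarge : ∀ (L : ℕ), ∃ N₁ : ℕ, 0 < N₁ ∧ ∀ (b₀ p₀ Λ : ℝ), 0 < b₀ → 2 < p₀ → 1 < Λ →
    ∃ (γ₁ C c : ℝ) (N : ℕ), 0 < γ₁ ∧ γ₁ ≤ 1 ∧ 0 < c ∧ ∀ (F : T3Family) (γ : ℝ), F.L = L → 0 < γ → γ ≤ γ₁ →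
      ∀ (b : ℝ), b₀ ≤ b → ∀ (K n j : ℕ), 1 ≤ j → N₁ * j + n ≤ K →
        1 < T3UnitScaleTilt.θBal F.L γ (Λ * b) p₀ (K - j) → ∀ p : Plaq (F.P K) j,
        (T3UnitScaleTilt.gibbsK F T3UnitLawDensityEML.ℰp γ K).real
          {U | (∀ k, k < j → PlaqSmall (T3UnitScaleTilt.θBal F.L γ b p₀ (K - k))
                (Averaging.iter (fun i => BlockAveraging.blockAvg (P := F.P K) (j := i) T3UnitLawDensityEML.ℰp) k U)) ∧
              (∀ j', j ≤ j' → j' + n ≤ K → PlaqSmall (T3UnitScaleTilt.θBal F.L γ (Λ * b) p₀ (K - j'))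
                (Averaging.iter (fun i => BlockAveraging.blockAvg (P := F.P K) (j := i) T3UnitLawDensityEML.ℰp) j' U)) ∧
              T3UnitScaleTilt.θBal F.L γ b p₀ (K - j) ≤ GaugeGroup.dist1 (GaugeField.plaqHol
                (Averaging.iter (fun i => BlockAveraging.blockAvg (P := F.P K) (j := i) T3UnitLawDensityEML.ℰp) j U) p)}
        ≤ C * ((γ * ((F.L : ℝ)⁻¹) ^ (K - j))⁻¹) ^ N *
            Real.exp (-(c * B10.pFun b₀ p₀ (Real.sqrt (γ * ((F.L : ℝ)⁻¹) ^ (K - j))) ^ 2)) := by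
  sorry

/-- STUB 1c (M — (α′) «SW-LARGE-BASE AT EVERY DEPTH, NO COUPLING», seat ym-ust-19936-w5 g13 SIGNATURE 08:23:10Z
`Theorems/CovariantDischargeSandwichLargeBase.sandwichTail_of_large_base` (HOME sha16 dc36a224894e447b) — STATEMENT COPIED TOKEN FOR TOKEN so the
landed theorem discharges it by name; (L′) of `LOCATE-SWGAP-px8g6` §3): on the LARGE BASE `2·(151L²)^j·b₀ ≤ b` the sandwich event at EVERY
height `j + n ≤ K` is `≤ C·β_{K−j}^N·exp(−c·p(g_{K−j})(b₀)²)`, no coupling, no regime: footprint threshold `θ(b)(K−j)/(151L²)^j` with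
`β_K·(θ(b)/Λ_L^j)²/4 ≥ L^j·p(b₀)²` once `b ≥ 2Λ_L^j b₀`, and the spare `e^{−(L^j−1)p(b₀)²}` (`p(b₀) ≥ b₀`) eats `(81L³)^j·L^{5j}`.  `γ₁ = 1`,
`c = 1`, `N = 5`. [cite: Balaban1985Averaging, Prop. 1 (51) p.26; Balaban1985UV3, (7) p.257 and (71) p.273; FrohlichIsraelLiebSimon1978, Thm 4.1] -/
theorem stub_sandwichLargeBase : ∀ (L : ℕ) (b₀ p₀ Λ : ℝ), 0 < b₀ → 2 < p₀ → 1 < Λ →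
    ∃ (γ₁ C c : ℝ) (N : ℕ), 0 < γ₁ ∧ γ₁ ≤ 1 ∧ 0 < c ∧ ∀ (F : T3Family) (γ : ℝ), F.L = L → 0 < γ → γ ≤ γ₁ →
      ∀ (b : ℝ), b₀ ≤ b → ∀ (K n j : ℕ), j + n ≤ K → 2 * (151 * (L : ℝ) ^ 2) ^ j * b₀ ≤ b → ∀ p : Plaq (F.P K) j,
        (T3UnitScaleTilt.gibbsK F T3UnitLawDensityEML.ℰp γ K).real
          {U | (∀ k, k < j → PlaqSmall (T3UnitScaleTilt.θBal F.L γ b p₀ (K - k))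
                (Averaging.iter (fun i => BlockAveraging.blockAvg (P := F.P K) (j := i) T3UnitLawDensityEML.ℰp) k U)) ∧
              (∀ j', j ≤ j' → j' + n ≤ K → PlaqSmall (T3UnitScaleTilt.θBal F.L γ (Λ * b) p₀ (K - j'))
                (Averaging.iter (fun i => BlockAveraging.blockAvg (P := F.P K) (j := i) T3UnitLawDensityEML.ℰp) j' U)) ∧
              T3UnitScaleTilt.θBal F.L γ b p₀ (K - j) ≤ GaugeGroup.dist1 (GaugeField.plaqHol
                (Averaging.iter (fun i => BlockAveraging.blockAvg (P := F.P K) (j := i) T3UnitLawDensityEML.ℰp) j U) p)}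
        ≤ C * ((γ * ((F.L : ℝ)⁻¹) ^ (K - j))⁻¹) ^ N *
            Real.exp (-(c * B10.pFun b₀ p₀ (Real.sqrt (γ * ((F.L : ℝ)⁻¹) ^ (K - j))) ^ 2)) := by
  sorry

/-- **PROVED REDUCTION (kernel-checked, no sorry).**  STUB 1a′ + ✓p708497 + STUB 1c ⇒ the ladder-uniform sandwich bound on the sweep range
`j₀ < j`, `N₁·j + n ≤ K` (`N₁ := max`, `γ₁ := min`, `C := |#net·e^D| + |C_b| + |C_c|`, `c := min`, `N := max`), by the 3-way split of
`LOCATE-SWGAP-px8g6` §3 (M′): CAP ∧ small regime — the sandwich event lies in `A ∩ {dist1 H ≤ θ(Λb)} ∩ {θ(b) ≤ dist1 H}` (`A` = finer ∧ coarser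
conjuncts, `H = Ū^j(∂p)`; the coarse conjunct AT `j′ = j` is the upper window) and `CovariantDischargeSweepGapReduction.measureReal_dist1_window_le_card_mul_exp`
(direction net `exists_finset_sphere_inner_ge`, union bound, Cameron–Martin tail) applies; CAP ∧ large regime — the landed
`CovariantDischargeSandwichLarge.stub_sandwichLarge` (hypothesis `hLg`, discharged by name below); LARGE BASE — STUB 1c directly.
[cite: Balaban1985UV3, (1)-(3) p.256] -/
theorem sandwichSweep_of_capped_large_base
    (hG : ∀ (L : ℕ), ∃ N₁ : ℕ, 0 < N₁ ∧ ∀ (b₀ p₀ Λ : ℝ), 0 < b₀ → 2 < p₀ → 1 < Λ →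
      ∃ (j₀ : ℕ) (γ₁ cg D δ : ℝ), 0 < γ₁ ∧ γ₁ ≤ 1 ∧ 0 < cg ∧ 0 < δ ∧ δ ^ 2 ≤ 2 ∧
        ∀ (F : T3Family) (γ : ℝ), F.L = L → 0 < γ → γ ≤ γ₁ → ∀ (b : ℝ), b₀ ≤ b → ∀ (K n j : ℕ), j₀ < j → N₁ * j + n ≤ K →
          b ≤ 2 * (151 * (F.L : ℝ) ^ 2) ^ j * b₀ → T3UnitScaleTilt.θBal F.L γ (Λ * b) p₀ (K - j) ≤ 1 →
          ∀ (p : Plaq (F.P K) j) (v : EuclideanSpace ℝ (Fin 3)), ‖v‖ = 1 →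
            ∃ (Ψ Ψ' : GaugeField (F.P K) 0 (Matrix.specialUnitaryGroup (Fin 2) ℂ) → GaugeField (F.P K) 0 (Matrix.specialUnitaryGroup (Fin 2) ℂ)),
              MeasurePreserving Ψ (fieldMeasure (F.P K) 0 (Matrix.specialUnitaryGroup (Fin 2) ℂ)) (fieldMeasure (F.P K) 0 (Matrix.specialUnitaryGroup (Fin 2) ℂ)) ∧ Measurable Ψ' ∧
              Function.LeftInverse Ψ' Ψ ∧ Function.RightInverse Ψ' Ψ ∧
              ∀ V : GaugeField (F.P K) 0 (Matrix.specialUnitaryGroup (Fin 2) ℂ),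
                (∀ k, k < j → PlaqSmall (T3UnitScaleTilt.θBal F.L γ b p₀ (K - k))
                  (Averaging.iter (fun i => BlockAveraging.blockAvg (P := F.P K) (j := i) T3UnitLawDensityEML.ℰp) k V)) →
                (∀ j', j ≤ j' → j' + n ≤ K → PlaqSmall (T3UnitScaleTilt.θBal F.L γ (Λ * b) p₀ (K - j'))
                  (Averaging.iter (fun i => BlockAveraging.blockAvg (P := F.P K) (j := i) T3UnitLawDensityEML.ℰp) j' V)) →
                (1 - δ ^ 2 / 2) * (T3UnitScaleTilt.θBal F.L γ b p₀ (K - j) *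
                    Real.sqrt (1 - T3UnitScaleTilt.θBal F.L γ (Λ * b) p₀ (K - j) ^ 2 / 4)) ≤
                  ⟪v, T4ExpWindowSmallField.imVec (Literature.MathematicalPhysics.QuantumLattice.su2Quat (GaugeField.plaqHol
                    (Averaging.iter (fun i => BlockAveraging.blockAvg (P := F.P K) (j := i) T3UnitLawDensityEML.ℰp) j V) p))⟫ →
                cg * B10.pFun b₀ p₀ (Real.sqrt (γ * ((F.L : ℝ)⁻¹) ^ (K - j))) ^ 2 - D ≤
                  (F.scheme T3UnitLawDensityEML.ℰp γ).β K * (wilsonAction4 V - wilsonAction4 (Ψ' V)))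
    (hLg : ∀ (L : ℕ), ∃ N₁ : ℕ, 0 < N₁ ∧ ∀ (b₀ p₀ Λ : ℝ), 0 < b₀ → 2 < p₀ → 1 < Λ →
      ∃ (γ₁ C c : ℝ) (N : ℕ), 0 < γ₁ ∧ γ₁ ≤ 1 ∧ 0 < c ∧ ∀ (F : T3Family) (γ : ℝ), F.L = L → 0 < γ → γ ≤ γ₁ →
        ∀ (b : ℝ), b₀ ≤ b → ∀ (K n j : ℕ), 1 ≤ j → N₁ * j + n ≤ K →
          1 < T3UnitScaleTilt.θBal F.L γ (Λ * b) p₀ (K - j) → ∀ p : Plaq (F.P K) j,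
          (T3UnitScaleTilt.gibbsK F T3UnitLawDensityEML.ℰp γ K).real
            {U | (∀ k, k < j → PlaqSmall (T3UnitScaleTilt.θBal F.L γ b p₀ (K - k))
                  (Averaging.iter (fun i => BlockAveraging.blockAvg (P := F.P K) (j := i) T3UnitLawDensityEML.ℰp) k U)) ∧
                (∀ j', j ≤ j' → j' + n ≤ K → PlaqSmall (T3UnitScaleTilt.θBal F.L γ (Λ * b) p₀ (K - j'))
                  (Averaging.iter (fun i => BlockAveraging.blockAvg (P := F.P K) (j := i) T3UnitLawDensityEML.ℰp) j' U)) ∧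
                T3UnitScaleTilt.θBal F.L γ b p₀ (K - j) ≤ GaugeGroup.dist1 (GaugeField.plaqHol
                  (Averaging.iter (fun i => BlockAveraging.blockAvg (P := F.P K) (j := i) T3UnitLawDensityEML.ℰp) j U) p)}
          ≤ C * ((γ * ((F.L : ℝ)⁻¹) ^ (K - j))⁻¹) ^ N *
              Real.exp (-(c * B10.pFun b₀ p₀ (Real.sqrt (γ * ((F.L : ℝ)⁻¹) ^ (K - j))) ^ 2)))
    (hLB : ∀ (L : ℕ) (b₀ p₀ Λ : ℝ), 0 < b₀ → 2 < p₀ → 1 < Λ →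
      ∃ (γ₁ C c : ℝ) (N : ℕ), 0 < γ₁ ∧ γ₁ ≤ 1 ∧ 0 < c ∧ ∀ (F : T3Family) (γ : ℝ), F.L = L → 0 < γ → γ ≤ γ₁ →
        ∀ (b : ℝ), b₀ ≤ b → ∀ (K n j : ℕ), j + n ≤ K → 2 * (151 * (L : ℝ) ^ 2) ^ j * b₀ ≤ b → ∀ p : Plaq (F.P K) j,
          (T3UnitScaleTilt.gibbsK F T3UnitLawDensityEML.ℰp γ K).real
            {U | (∀ k, k < j → PlaqSmall (T3UnitScaleTilt.θBal F.L γ b p₀ (K - k))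
                  (Averaging.iter (fun i => BlockAveraging.blockAvg (P := F.P K) (j := i) T3UnitLawDensityEML.ℰp) k U)) ∧
                (∀ j', j ≤ j' → j' + n ≤ K → PlaqSmall (T3UnitScaleTilt.θBal F.L γ (Λ * b) p₀ (K - j'))
                  (Averaging.iter (fun i => BlockAveraging.blockAvg (P := F.P K) (j := i) T3UnitLawDensityEML.ℰp) j' U)) ∧
                T3UnitScaleTilt.θBal F.L γ b p₀ (K - j) ≤ GaugeGroup.dist1 (GaugeField.plaqHol
                  (Averaging.iter (fun i => BlockAveraging.blockAvg (P := F.P K) (j := i) T3UnitLawDensityEML.ℰp) j U) p)}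
          ≤ C * ((γ * ((F.L : ℝ)⁻¹) ^ (K - j))⁻¹) ^ N *
              Real.exp (-(c * B10.pFun b₀ p₀ (Real.sqrt (γ * ((F.L : ℝ)⁻¹) ^ (K - j))) ^ 2))) :
    ∀ (L : ℕ), ∃ N₁ : ℕ, 0 < N₁ ∧ ∀ (b₀ p₀ Λ : ℝ), 0 < b₀ → 2 < p₀ → 1 < Λ →
    ∃ (j₀ : ℕ) (γ₁ C c : ℝ) (N : ℕ), 0 < γ₁ ∧ γ₁ ≤ 1 ∧ 0 < c ∧ ∀ (F : T3Family) (γ : ℝ), F.L = L → 0 < γ → γ ≤ γ₁ →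
      ∀ (b : ℝ), b₀ ≤ b → ∀ (K n j : ℕ), j₀ < j → N₁ * j + n ≤ K → ∀ p : Plaq (F.P K) j,
        (T3UnitScaleTilt.gibbsK F T3UnitLawDensityEML.ℰp γ K).real
          {U | (∀ k, k < j → PlaqSmall (T3UnitScaleTilt.θBal F.L γ b p₀ (K - k))
                (Averaging.iter (fun i => BlockAveraging.blockAvg (P := F.P K) (j := i) T3UnitLawDensityEML.ℰp) k U)) ∧
              (∀ j', j ≤ j' → j' + n ≤ K → PlaqSmall (T3UnitScaleTilt.θBal F.L γ (Λ * b) p₀ (K - j'))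
                (Averaging.iter (fun i => BlockAveraging.blockAvg (P := F.P K) (j := i) T3UnitLawDensityEML.ℰp) j' U)) ∧
              T3UnitScaleTilt.θBal F.L γ b p₀ (K - j) ≤ GaugeGroup.dist1 (GaugeField.plaqHol
                (Averaging.iter (fun i => BlockAveraging.blockAvg (P := F.P K) (j := i) T3UnitLawDensityEML.ℰp) j U) p)}
        ≤ C * ((γ * ((F.L : ℝ)⁻¹) ^ (K - j))⁻¹) ^ N *
            Real.exp (-(c * B10.pFun b₀ p₀ (Real.sqrt (γ * ((F.L : ℝ)⁻¹) ^ (K - j))) ^ 2)) := by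
  intro L
  obtain ⟨Na, hNa, hGa⟩ := hG L
  obtain ⟨Nb, hNb, hLb⟩ := hLg L
  refine ⟨max Na Nb, lt_max_of_lt_left hNa, fun b₀ p₀ Λ hb₀ hp₀ hΛ => ?_⟩
  obtain ⟨j₀, γa, cg, D, δ, hγa, hγa1, hcg, hδ, hδ2, hG'⟩ := hGa b₀ p₀ Λ hb₀ hp₀ hΛ
  obtain ⟨γb, Cb, cb, Nb', hγb, hγb1, hcb, hB⟩ := hLb b₀ p₀ Λ hb₀ hp₀ hΛ
  obtain ⟨γc, Cc, cc, Nc, hγc, hγc1, hcc, hC⟩ := hLB L b₀ p₀ Λ hb₀ hp₀ hΛ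
  obtain ⟨s, _hne, hs1, hnet⟩ := exists_finset_sphere_inner_ge (E := EuclideanSpace ℝ (Fin 3)) hδ
  refine ⟨j₀, min γa (min γb γc), |(s.card : ℝ) * Real.exp D| + |Cb| + |Cc|, min cg (min cb cc), max Nb' Nc,
    lt_min hγa (lt_min hγb hγc), (min_le_left _ _).trans hγa1, lt_min hcg (lt_min hcb hcc), ?_⟩
  intro F γ hFL hγ hγ1 b hb K n j hj hjK p
  have hγa' : γ ≤ γa := hγ1.trans (min_le_left _ _)
  have hγb' : γ ≤ γb := hγ1.trans ((min_le_right _ _).trans (min_le_left _ _))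
  have hγc' : γ ≤ γc := hγ1.trans ((min_le_right _ _).trans (min_le_right _ _))
  have hγone : γ ≤ 1 := hγa'.trans hγa1
  have hβ := Summit.QuantumFields.YangMills.Theorems.SandwichDischargeDoor.sd_one_le_beta F hγ hγone K j
  have ht : (0 : ℝ) ≤ B10.pFun b₀ p₀ (Real.sqrt (γ * ((F.L : ℝ)⁻¹) ^ (K - j))) ^ 2 := sq_nonneg _
  have hCa : |(s.card : ℝ) * Real.exp D| ≤ |(s.card : ℝ) * Real.exp D| + |Cb| + |Cc| := by
    linarith [abs_nonneg Cb, abs_nonneg Cc]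
  have hCb : |Cb| ≤ |(s.card : ℝ) * Real.exp D| + |Cb| + |Cc| := by
    linarith [abs_nonneg ((s.card : ℝ) * Real.exp D), abs_nonneg Cc]
  have hCc : |Cc| ≤ |(s.card : ℝ) * Real.exp D| + |Cb| + |Cc| := by
    linarith [abs_nonneg ((s.card : ℝ) * Real.exp D), abs_nonneg Cb]
  have hcga : min cg (min cb cc) ≤ cg := min_le_left _ _
  have hcgb : min cg (min cb cc) ≤ cb := (min_le_right _ _).trans (min_le_left _ _)
  have hcgc : min cg (min cb cc) ≤ cc := (min_le_right _ _).trans (min_le_right _ _)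
  have hja : Na * j ≤ max Na Nb * j := Nat.mul_le_mul_right j (le_max_left Na Nb)
  have hjb : Nb * j ≤ max Na Nb * j := Nat.mul_le_mul_right j (le_max_right Na Nb)
  have hjKa : Na * j + n ≤ K := by omega
  have hjKb : Nb * j + n ≤ K := by omega
  have hj1 : 1 ≤ j := by omega
  have hjn : j + n ≤ K := by
    have : j ≤ Na * j := Nat.le_mul_of_pos_left j hNa
    omega
  have hL1 : 1 ≤ F.L := F.hL.2.le
  haveI := T3UnitScaleTilt.isProbabilityMeasure_gibbsK F ℰp hγ.le K
  by_cases hcap : b ≤ 2 * (151 * (F.L : ℝ) ^ 2) ^ j * b₀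
  · by_cases hsm : T3UnitScaleTilt.θBal F.L γ (Λ * b) p₀ (K - j) ≤ 1
    · -- CAP ∧ small regime: the window reduction of `CovariantDischargeSweepGapReduction`
      refine Summit.QuantumFields.YangMills.Theorems.SandwichDischargeDoor.sd_schema_mono hβ (Nat.zero_le _) hcga ht hCa ?_
      have hb0 : 0 < b := hb₀.trans_le hb
      set θ : ℝ := T3UnitScaleTilt.θBal F.L γ b p₀ (K - j) with hθ_def
      set θ₂ : ℝ := T3UnitScaleTilt.θBal F.L γ (Λ * b) p₀ (K - j) with hθ₂_def
      have hθ0 : 0 ≤ θ := (θBal_pos hL1 hγ hγone hb0 p₀ (K - j)).le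
      have hθ₂2 : θ₂ ≤ 2 := hsm.trans one_le_two
      set A : Set (GaugeField (F.P K) 0 SU2) :=
        {U | (∀ k, k < j → PlaqSmall (T3UnitScaleTilt.θBal F.L γ b p₀ (K - k))
            (Averaging.iter (fun i => BlockAveraging.blockAvg (P := F.P K) (j := i) ℰp) k U)) ∧
          (∀ j', j ≤ j' → j' + n ≤ K → PlaqSmall (T3UnitScaleTilt.θBal F.L γ (Λ * b) p₀ (K - j'))
            (Averaging.iter (fun i => BlockAveraging.blockAvg (P := F.P K) (j := i) ℰp) j' U))} with hA_def
      set H : GaugeField (F.P K) 0 SU2 → SU2 := fun U =>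
        GaugeField.plaqHol (Averaging.iter (fun i => BlockAveraging.blockAvg (P := F.P K) (j := i) ℰp) j U) p with hH_def
      haveI := T4GenFunBounds.isProbabilityMeasure_gibbsMeasure (G := SU2) (F.P K) (F.scheme_β_nonneg ℰp hγ.le K)
      have hsub : {U | (∀ k, k < j → PlaqSmall (T3UnitScaleTilt.θBal F.L γ b p₀ (K - k))
                  (Averaging.iter (fun i => BlockAveraging.blockAvg (P := F.P K) (j := i) ℰp) k U)) ∧
                (∀ j', j ≤ j' → j' + n ≤ K → PlaqSmall (T3UnitScaleTilt.θBal F.L γ (Λ * b) p₀ (K - j'))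
                  (Averaging.iter (fun i => BlockAveraging.blockAvg (P := F.P K) (j := i) ℰp) j' U)) ∧
                T3UnitScaleTilt.θBal F.L γ b p₀ (K - j) ≤ GaugeGroup.dist1 (GaugeField.plaqHol
                  (Averaging.iter (fun i => BlockAveraging.blockAvg (P := F.P K) (j := i) ℰp) j U) p)} ⊆
          {U | U ∈ A ∧ dist1 (H U) ≤ θ₂ ∧ θ ≤ dist1 (H U)} := by
        intro U hU
        exact ⟨⟨hU.1, hU.2.1⟩, (hU.2.1 j le_rfl hjn p).le, hU.2.2⟩
      have hgap : ∀ v ∈ s, ∃ Ψ Ψ' : GaugeField (F.P K) 0 SU2 → GaugeField (F.P K) 0 SU2,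
          MeasurePreserving Ψ (fieldMeasure (F.P K) 0 SU2) (fieldMeasure (F.P K) 0 SU2) ∧ Measurable Ψ' ∧
          Function.LeftInverse Ψ' Ψ ∧ Function.RightInverse Ψ' Ψ ∧
          ∀ V : GaugeField (F.P K) 0 SU2, V ∈ A → dist1 (H V) ≤ θ₂ →
            (1 - δ ^ 2 / 2) * (θ * Real.sqrt (1 - θ₂ ^ 2 / 4)) ≤ ⟪v, imVec (su2Quat (H V))⟫ →
            cg * B10.pFun b₀ p₀ (Real.sqrt (γ * ((F.L : ℝ)⁻¹) ^ (K - j))) ^ 2 - D ≤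
              (F.scheme ℰp γ).β K * (wilsonAction4 V - wilsonAction4 (Ψ' V)) := by
        intro v hv
        obtain ⟨Ψ, Ψ', hΨ, hΨ', h₁, h₂, hg⟩ := hG' F γ hFL hγ hγa' b hb K n j hj hjKa hcap hsm p v (hs1 v hv)
        exact ⟨Ψ, Ψ', hΨ, hΨ', h₁, h₂, fun V hV _ hlin => hg V hV.1 hV.2 hlin⟩
      have hmain := measureReal_dist1_window_le_card_mul_exp (P := F.P K) (F.scheme_β_nonneg ℰp hγ.le K) s
        (by linarith : (0 : ℝ) ≤ 1 - δ ^ 2 / 2) hnet A H hθ0 hθ₂2 hgap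
      rw [pow_zero, mul_one, T3UnitScaleTilt.gibbsK_eq]
      refine ((measureReal_mono hsub (measure_ne_top _ _)).trans hmain).trans (le_of_eq ?_)
      rw [mul_assoc, ← Real.exp_add]
      congr 1
      congr 1
      ring
    · -- CAP ∧ large regime: the landed `stub_sandwichLarge` (hypothesis `hLg`)
      exact Summit.QuantumFields.YangMills.Theorems.SandwichDischargeDoor.sd_schema_mono hβ (le_max_left _ _) hcgb ht hCb
        (hB F γ hFL hγ hγb' b hb K n j hj1 hjKb (not_le.mp hsm) p)
  · -- LARGE BASE: STUB 1c (the sandwich event at every depth `j + n ≤ K`, no coupling, no regime)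
    have hcap' : 2 * (151 * (L : ℝ) ^ 2) ^ j * b₀ ≤ b := by
      rw [← hFL]
      exact (not_le.mp hcap).le
    exact Summit.QuantumFields.YangMills.Theorems.SandwichDischargeDoor.sd_schema_mono hβ (le_max_right _ _) hcgc ht hCc
      (hC F γ hFL hγ hγc' b hb K n j hjn hcap' p)

/-- STUB 2 (RESIDUAL, organ-class): the route item `SandwichDeepWindowTailL` verbatim. [cite: Balaban1989LargeFieldII, Thm 1 p.358; Balaban1988Convergent] -/
theorem stub_sandwichDeep : SandwichDeepWindowTailL := by
  sorry

/-- The route's support item `HistoryTailOfSandwichSplit` — PROVED in the tree (`Theorems.CovariantDischargeHistoryTailOfSandwichSplit`, p705200). -/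
theorem sandwichDoor : HistoryTailOfSandwichSplit :=
  Summit.QuantumFields.YangMills.Theorems.SandwichDischargeDoor.door

/-- The two height ranges merge to the route's crux `SandwichFractionalWindowTailL` (constants merged: `γ₁ = min`,
`C = |C₁| + |C₂|`, `c = min`, `N = N₁' + N₂'`; `β ≥ 1`). Kernel-checked, no sorry. [folklore] -/
theorem sandwichFractional_of_ranges
    (h₁ : ∀ (L j₀ : ℕ) (b₀ p₀ Λ : ℝ), 0 < b₀ → 2 < p₀ → 1 < Λ →
      ∃ (γ₁ C c : ℝ) (N : ℕ), 0 < γ₁ ∧ γ₁ ≤ 1 ∧ 0 < c ∧ ∀ (F : T3Family) (γ : ℝ), F.L = L → 0 < γ → γ ≤ γ₁ →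
        ∀ (b : ℝ), b₀ ≤ b → ∀ (K n j : ℕ), j ≤ j₀ → j + n ≤ K → ∀ p : Plaq (F.P K) j,
          (T3UnitScaleTilt.gibbsK F T3UnitLawDensityEML.ℰp γ K).real
            {U | (∀ k, k < j → PlaqSmall (T3UnitScaleTilt.θBal F.L γ b p₀ (K - k))
                  (Averaging.iter (fun i => BlockAveraging.blockAvg (P := F.P K) (j := i) T3UnitLawDensityEML.ℰp) k U)) ∧
                (∀ j', j ≤ j' → j' + n ≤ K → PlaqSmall (T3UnitScaleTilt.θBal F.L γ (Λ * b) p₀ (K - j'))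
                  (Averaging.iter (fun i => BlockAveraging.blockAvg (P := F.P K) (j := i) T3UnitLawDensityEML.ℰp) j' U)) ∧
                T3UnitScaleTilt.θBal F.L γ b p₀ (K - j) ≤ GaugeGroup.dist1 (GaugeField.plaqHol
                  (Averaging.iter (fun i => BlockAveraging.blockAvg (P := F.P K) (j := i) T3UnitLawDensityEML.ℰp) j U) p)}
          ≤ C * ((γ * ((F.L : ℝ)⁻¹) ^ (K - j))⁻¹) ^ N *
              Real.exp (-(c * B10.pFun b₀ p₀ (Real.sqrt (γ * ((F.L : ℝ)⁻¹) ^ (K - j))) ^ 2)))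
    (h₂ : ∀ (L : ℕ), ∃ N₁ : ℕ, 0 < N₁ ∧ ∀ (b₀ p₀ Λ : ℝ), 0 < b₀ → 2 < p₀ → 1 < Λ →
      ∃ (j₀ : ℕ) (γ₁ C c : ℝ) (N : ℕ), 0 < γ₁ ∧ γ₁ ≤ 1 ∧ 0 < c ∧ ∀ (F : T3Family) (γ : ℝ), F.L = L → 0 < γ → γ ≤ γ₁ →
        ∀ (b : ℝ), b₀ ≤ b → ∀ (K n j : ℕ), j₀ < j → N₁ * j + n ≤ K → ∀ p : Plaq (F.P K) j,
          (T3UnitScaleTilt.gibbsK F T3UnitLawDensityEML.ℰp γ K).real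
            {U | (∀ k, k < j → PlaqSmall (T3UnitScaleTilt.θBal F.L γ b p₀ (K - k))
                  (Averaging.iter (fun i => BlockAveraging.blockAvg (P := F.P K) (j := i) T3UnitLawDensityEML.ℰp) k U)) ∧
                (∀ j', j ≤ j' → j' + n ≤ K → PlaqSmall (T3UnitScaleTilt.θBal F.L γ (Λ * b) p₀ (K - j'))
                  (Averaging.iter (fun i => BlockAveraging.blockAvg (P := F.P K) (j := i) T3UnitLawDensityEML.ℰp) j' U)) ∧
                T3UnitScaleTilt.θBal F.L γ b p₀ (K - j) ≤ GaugeGroup.dist1 (GaugeField.plaqHol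
                  (Averaging.iter (fun i => BlockAveraging.blockAvg (P := F.P K) (j := i) T3UnitLawDensityEML.ℰp) j U) p)}
          ≤ C * ((γ * ((F.L : ℝ)⁻¹) ^ (K - j))⁻¹) ^ N *
              Real.exp (-(c * B10.pFun b₀ p₀ (Real.sqrt (γ * ((F.L : ℝ)⁻¹) ^ (K - j))) ^ 2))) :
    -- the BODY of the route's crux `SandwichFractionalWindowTailL` (spelled out so that only the all-stubs form below concludes the
    -- crux by name — skeleton-check convention)
    ∀ (L : ℕ), ∃ N₁ : ℕ, 0 < N₁ ∧ ∀ (b₀ p₀ Λ : ℝ), 0 < b₀ → 2 < p₀ → 1 < Λ →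
      ∃ (γ₁ C c : ℝ) (N : ℕ), 0 < γ₁ ∧ γ₁ ≤ 1 ∧ 0 < c ∧
      ∀ (F : T3Family) (γ : ℝ), F.L = L → 0 < γ → γ ≤ γ₁ →
      ∀ (b : ℝ), b₀ ≤ b → ∀ (K n j : ℕ), N₁ * j + n ≤ K → ∀ p : Plaq (F.P K) j,
      (T3UnitScaleTilt.gibbsK F T3UnitLawDensityEML.ℰp γ K).real
        {U | (∀ k, k < j → PlaqSmall (T3UnitScaleTilt.θBal F.L γ b p₀ (K - k)) (Averaging.iter (fun i => BlockAveraging.blockAvg (P := F.P K) (j := i) T3UnitLawDensityEML.ℰp) k U)) ∧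
          (∀ j', j ≤ j' → j' + n ≤ K → PlaqSmall (T3UnitScaleTilt.θBal F.L γ (Λ * b) p₀ (K - j')) (Averaging.iter (fun i => BlockAveraging.blockAvg (P := F.P K) (j := i) T3UnitLawDensityEML.ℰp) j' U)) ∧
          T3UnitScaleTilt.θBal F.L γ b p₀ (K - j) ≤ GaugeGroup.dist1 (GaugeField.plaqHol (Averaging.iter (fun i => BlockAveraging.blockAvg (P := F.P K) (j := i) T3UnitLawDensityEML.ℰp) j U) p)}
        ≤ C * ((γ * ((F.L : ℝ)⁻¹) ^ (K - j))⁻¹) ^ N * Real.exp (-(c * B10.pFun b₀ p₀ (Real.sqrt (γ * ((F.L : ℝ)⁻¹) ^ (K - j))) ^ 2)) := by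
  intro L
  obtain ⟨N₁, hN₁, hS⟩ := h₂ L
  refine ⟨N₁, hN₁, ?_⟩
  intro b₀ p₀ Λ hb₀ hp₀ hΛ
  obtain ⟨j₀, γb, Cb, cb, Nb, hγb, hγb1, hcb, hB⟩ := hS b₀ p₀ Λ hb₀ hp₀ hΛ
  obtain ⟨γa, Ca, ca, Na, hγa, hγa1, hca, hA⟩ := h₁ L j₀ b₀ p₀ Λ hb₀ hp₀ hΛ
  refine ⟨min γa γb, |Ca| + |Cb|, min ca cb, Na + Nb, lt_min hγa hγb, (min_le_left _ _).trans hγa1,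
    lt_min hca hcb, ?_⟩
  intro F γ hFL hγ hγ1 b hb K n j hjK p
  have hγa' : γ ≤ γa := hγ1.trans (min_le_left _ _)
  have hγb' : γ ≤ γb := hγ1.trans (min_le_right _ _)
  have hβ := Summit.QuantumFields.YangMills.Theorems.SandwichDischargeDoor.sd_one_le_beta F hγ (hγa'.trans hγa1) K j
  have ht : (0 : ℝ) ≤ B10.pFun b₀ p₀ (Real.sqrt (γ * ((F.L : ℝ)⁻¹) ^ (K - j))) ^ 2 := sq_nonneg _
  have hCa : |Ca| ≤ |Ca| + |Cb| := by linarith [abs_nonneg Cb]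
  have hCb : |Cb| ≤ |Ca| + |Cb| := by linarith [abs_nonneg Ca]
  by_cases hj : j ≤ j₀
  · have hjK' : j + n ≤ K := by
      have : j ≤ N₁ * j := Nat.le_mul_of_pos_left j hN₁
      omega
    exact Summit.QuantumFields.YangMills.Theorems.SandwichDischargeDoor.sd_schema_mono hβ (by omega) (min_le_left _ _) ht hCa (hA F γ hFL hγ hγa' b hb K n j hj hjK' p)
  · exact Summit.QuantumFields.YangMills.Theorems.SandwichDischargeDoor.sd_schema_mono hβ (by omega) (min_le_right _ _) ht hCb (hB F γ hFL hγ hγb' b hb K n j (by omega) hjK p)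

/-- The route's crux `SandwichFractionalWindowTailL` (stmt-QuantumFields-24186) from the registered stubs BY NAME: bounded depth (proved)
+ the merged sweep range `sandwichSweep_of_capped_large_base stub_sandwichSweepGapCapped stub_sandwichLarge stub_sandwichLargeBase`
(`stub_sandwichLarge` = the landed ✓p708497 by name, no sorry). -/
theorem SandwichFractionalWindowTailL_of : SandwichFractionalWindowTailL :=
  sandwichFractional_of_ranges sandwichBoundedDepth
    (sandwichSweep_of_capped_large_base stub_sandwichSweepGapCapped
      stub_sandwichLarge stub_sandwichLargeBase)

/-- **THE COMPOSITION (kernel-checked, no sorry outside the registered stubs).** The crux `UnitScaleTilt.HistoryTailL` BY NAME from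
the route's residual item `SandwichDeepWindowTailL` (registered obligation, by name) — the stubs `stub_sandwichSweepGapCapped`,
`stub_sandwichLargeBase` and the landed ✓`stub_sandwichLarge` enter through `SandwichFractionalWindowTailL_of`, the door is the landed
`SandwichDischargeDoor.door`. -/
theorem HistoryTailL_of (h₃ : SandwichDeepWindowTailL) :
    Summit.QuantumFields.YangMills.Theses.UnitScaleTilt.HistoryTailL :=
  Summit.QuantumFields.YangMills.Theorems.SandwichDischargeDoor.door SandwichFractionalWindowTailL_of h₃

/-- Alias in the `_of_stubs` convention for the route's crux stmt-QuantumFields-24186. -/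
theorem SandwichFractionalWindowTailL_of_stubs : SandwichFractionalWindowTailL :=
  SandwichFractionalWindowTailL_of

/-- All-stubs form (no hypotheses): the three registered stubs give the crux. -/
theorem HistoryTailL_of_stubs : Summit.QuantumFields.YangMills.Theses.UnitScaleTilt.HistoryTailL :=
  HistoryTailL_of stub_sandwichDeep

end Summit.QuantumFields.YangMills.Cruxes.HistoryTailL.SandwichDischarge

end
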